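import Literature.AlgebraicGeometry.Hyperkaehler.OGradySixType
import Literature.AlgebraicGeometry.HodgeTheory.HardLefschetzNFoldHolds
import Literature.AlgebraicTopology.SingularHomology.KroneckerDegreeOne
import HarnessLib

/-!
# Odd cohomology of irreducible symplectic (hyper-Kähler) varieties: the top odd cup product, Hodge level, and the Kuga–Satake lower bounds on `b₃`, `b_{2n-1}` (Voisin 2022, §§2–3) — NAMED FACTS + one derived corollary

Layer `Literature/AlgebraicGeometry/Hyperkaehler`.  Typed for the cross-ladder literature-typing tranche
LT-H4 (HodgeAV ladder, rungs H2/H3 ideation inputs; cell `pub/vhodge/lit-oqh`, seat `hodge-lit-oqh-1`):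
the "transfer lens" HK manifold `X` ↦ intermediate Jacobian `J³(X)` (O'Grady 2021, Markman 2023 for
`Kumⁿ`-type, tree records `Hyperkaehler.Markman2023_thirdCohomology_kummerType_discOneWeilFourfold`,
`Hyperkaehler.OGradyVoisin2022_thirdJacobian_kugaSatake_kummerType`, file `KummerTypeIntermediateJacobian`)
is governed, for an ARBITRARY hyper-Kähler manifold with odd cohomology, by the results of §§2–3 of

* C. Voisin, *Footnotes to papers of O'Grady and Markman*, Math. Z. 300 (2022), no. 4, 3405–3416
  (volume in honour of O. Debarre) = arXiv:2106.06979 [`Voisin2022FootnotesOGradyMarkman`; **REFEREED**].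
  Text read: held corpus `paper:arxiv-2106.06979` (12 chunks; locators `pNNNN:Lnn` below are chunk:line of
  that materialisation, theorem numbers are the journal's = arXiv v2's).

none of which the tree held (`lean search` 2026-08-26: the only `Voisin2022` records are the `Kumⁿ`-type §4
statements above).  Verbatim:

* **Cor. 2.4** (p0005:L75–L82): "If `X` is a hyper-Kähler manifold of dimension `2n` with
  `H^{2n-1}(X,ℚ) ≠ 0`, the cup-product map `⋀² H^{2n-1}(X,ℚ) → H²(X,ℚ)^*` is surjective."  (Target
  `H^{4n-2}(X,ℚ) ≅ H²(X,ℚ)^*` by Poincaré duality, p0005:L65–L70; proof: "the map `ψ` is nonzero and a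
  morphism of Hodge structures, the right hand side being a simple Hodge structure for a very general
  complex structure on `X`".)
* **Lemma 2.5** (p0005:L86–L95, p0006:L1–L3): "Let `X` be a hyper-Kähler `2n`-fold. Then the Hodge structure
  on the quotient `H^{2n-1}(X,ℚ)⁰ := H^{2n-1}(X,ℚ)/H² ∪ H^{2n-3}(X,ℚ)` has Hodge level `1`. In particular, if
  `H^{2n-3}(X,ℚ) = 0`, the Hodge structure on `H^{2n-1}(X,ℚ)` has Hodge level `1`.  Proof. The statement is
  that the `(p,q)`-components of `H^{2n-1}(X,ℂ)⁰` vanish unless `(p,q) = (n,n-1)` or `(p,q) = (n-1,n)`.  We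
  thus have to show that any class in `H^{p,q}(X)` with `p > n` or `q > n` belongs to
  `H²(X,ℂ) ∪ H^{2n-3}(X,ℂ)`."
* **Thm. 3.3** (p0008:L32–L39; = Thm. 1.3 (3) of the introduction, p0003:L49): "Let `X` be a hyper-Kähler
  manifold. Assume that `b₃(X) ≠ 0`. Then `b₃(X) ≥ 2ᵏ`, where `k = (b₂(X)-1)/2` if `b₂(X)` is odd,
  `k = (b₂(X)-2)/2` if `b₂(X)` is even.  If `b₂(X)` is divisible by `4`, the last inequality can be
  improved to `b₃(X) ≥ 2^{b₂(X)/2}`."  (Proof: Thm. 2.1 + Charles' universality of the Kuga–Satake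
  structure, Thm. 3.1, for a very general complex structure.)
* **Thm. 3.4** (p0008:L54–L62): "Let `X` be a hyper-Kähler manifold such that `H^{2n-3}(X) = 0` and
  `H^{2n-1}(X) ≠ 0`. Then `b_{2n-1}(X) ≥ 2ᵏ`, where `k = (b₂(X)-1)/2` if `b₂(X)` is odd, `k = (b₂(X)-2)/2`
  if `b₂(X)` is even.  If `b₂(X)` is divisible by `4`, the last inequality can be improved to
  `b_{2n-1}(X) ≥ 2^{b₂(X)/2}`."
* **Cor. 3.5** (p0009:L9–L18; = Cor. 1.4): "Let `X` be a hyper-Kähler `6`-fold such that `H^{odd}(X) ≠ 0`.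
  Then `b_{odd}(X) ≥ 2ᵏ`, where `k = (b₂-2)/2` if `b₂` is even, `k = (b₂-1)/2` if `b₂` is odd.  Proof. We
  observe that, in dimension `6`, if `H^{odd}(X) ≠ 0`, then either `H³(X,ℚ) ≠ 0` or, `H³(X,ℚ) = 0` and
  `H⁵(X,ℚ) ≠ 0`. In the first case we apply Theorem 3.3 and in the second case we apply Theorem 3.4."

## Rendering (tree carriers; nothing new is defined)

* "hyper-Kähler manifold of dimension `2n`" ↦ `IsProjectiveIrreducibleSymplectic (2 * n) X` for
  `X : Motives.SchemeOver ℂ` (file `OGradySixType`: smooth projective of dimension `2n`, `X(ℂ)` simply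
  connected, `H⁰(Ω²)` spanned by an everywhere non-degenerate holomorphic `2`-form on a Hodge model).  Print
  is about compact hyper-Kähler MANIFOLDS (Kähler, not necessarily projective); every statement below is its
  restriction to the PROJECTIVE ones — WEAKER than print, never stronger (Betti numbers, cup products and the
  Hodge decomposition are what the statements use; Voisin's proofs pass through a very general, non-projective,
  deformation, which is why the projective case is not a separate theorem in print but an instance).
  `-- TODO(general form): the compact hyper-Kähler (non-algebraic) case needs a manifold-level carrier
  (`Geometry.Hyperkaehler.IsIrreducibleSymplectic`) with its own singular cohomology bookkeeping.`
* `bₖ(X)` ↦ `Module.finrank ℂ (HodgeTheory.complexBetti X k)` (`Hᵏ(X(ℂ); ℂ)`; `= dim_ℚ Hᵏ(X, ℚ)`), as in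
  `OGradySixReference.finrank_complexBetti_two`; "`Hᵏ(X,ℚ) ≠ 0`" ↦ `bₖ ≠ 0`, "`= 0`" ↦ `bₖ = 0`.
* "`k = (b₂-1)/2` if `b₂` odd, `(b₂-2)/2` if `b₂` even" ↦ the single natural-number expression
  `(b₂ - 1) / 2` (floor division: for even `b₂ ≥ 2`, `⌊(b₂-1)/2⌋ = (b₂-2)/2`).  At `b₂ = 0` (impossible for a
  projective irreducible symplectic variety of positive dimension, which carries a non-zero ample class; in
  dimension `0` every odd Betti number vanishes and the hypotheses fail) it reads `2⁰ = 1 ≤ b₃`, which the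
  hypothesis `b₃ ≠ 0` already gives — so no instance is stronger than print.
* "cup-product map `⋀²H^{2n-1} → H^{4n-2}` surjective" ↦ the `ℂ`-span of `{a ∪ b}` (tree's Alexander–Whitney
  `cupProduct` on `complexBetti`) is all of `H^{4n-2}(X(ℂ); ℂ)` (surjectivity of a `ℚ`-bilinear map's span
  is equivalent to that of its complexification).
* "class in `H^{p,q}(X)`, `p + q = 2n-1`" ↦ `HodgeTheory.IsOfHodgeType (2 * n) X (2 * n - 1) p q c`;
  "`∈ H² ∪ H^{2n-3}`" ↦ membership in the `ℂ`-span of `{a ∪ b : a ∈ H², b ∈ H^{2n-3}}`.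
* Degrees `2n - 1`, `2n - 3` are natural-number subtractions guarded by the binders `1 ≤ n` / `2 ≤ n`
  (print: Lemma 2.5 and Thm. 3.4 are void for `n = 1`, where `H^{2n-3}` does not exist); the targets of cup
  products are spelled as the literal sums `(2n-1)+(2n-1)`, `2+(2n-3)` (no casts, no tactic in a statement).

## Content and accounting (D-0026: +4 named facts, each a REFEREED published theorem cited at the line; 1 derived theorem)

* facts `Voisin2022_cupProduct_topOddDegree_span_eq_top` (Cor. 2.4), `Voisin2022_hodgeLevel_topOddDegree`
  (Lemma 2.5), `Voisin2022_thirdBetti_lowerBound` (Thm. 3.3), `Voisin2022_topOddBetti_lowerBound` (Thm. 3.4);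
* PROVED here from the last two (kernel, following the printed proof word for word):
  `Voisin2022_oddBetti_sixfold_lowerBound` (Cor. 3.5), using the tree's theorems `H¹ = 0` for simply connected
  spaces (`isZero_singularCohomology_one_of_simplyConnectedSpace`, Hatcher Thm. 2A.1/§3.1) and hard Lefschetz
  (`HodgeTheory.nonempty_hardLefschetzNFold_holds`: `b₇ = b₅`, `b₉ = b₃`, `b₁₁ = b₁` on a sixfold);
* numerical instances (`example`s): `b₂ = 7` (the `Kumⁿ` value, O'Grady 2021 p. 2: "`b₃(X) = 8`") gives the
  bound `2³ = 8` — SHARP; `b₂ = 23` (K3^[n]) would force `b₃ ≥ 2¹¹`; `b₂ = 8, 24` (OG6, OG10; `4 ∣ b₂`) would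
  force `b₃ ≥ 2⁴, 2¹²` — consistent with `b_{odd} = 0` there (`OGradySixReference.finrank_complexBetti_odd`);
* LENS COROLLARIES (kernel, modulo Thm. 3.3): a projective irreducible symplectic host with `b₃ = 12`
  (`J³(X)` an abelian SIXFOLD) has `b₂ ≤ 7`; with `b₃ = 16` (`J³(X)` an EIGHTFOLD) `b₂ ≤ 10`
  (`Voisin2022_thirdBetti_lowerBound.betti_two_le_seven_of_thirdBetti_eq_twelve` / `…_le_ten_of_…_sixteen`).

Deliberately NOT here (no carrier in the tree, recorded for the lens seats): Thm. 2.1 / Prop. 2.2 (the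
O'Grady map `α ∧ β ↦ Q_X^{n-2} ∪ α ∪ β` is surjective for every hyper-Kähler `X` with `b₃ ≠ 0` — needs the
dual Beauville–Bogomolov class `Q_X ∈ H⁴(X, ℚ)`, p0005:L5–L13; for `Kumⁿ`-type its cohomological effect is
in `OGradyVoisin2022_thirdJacobian_kugaSatake_kummerType`); Thm. 1.3 (2) / Thm. 3.2 ("`J³(X)` contains a
simple component of the Kuga–Satake abelian variety of `H²(X,ℚ)_tr`" — needs Kuga–Satake carriers for
`2n`-folds; the tree's `HodgeTheory.IsKugaSatakeVarietyBetti` is for surfaces); Thm. 3.1 (Charles'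
universality, not Voisin's); §4 (typed in `KummerTypeIntermediateJacobian`).  Nothing here bears on the
Hodge conjecture beyond being INPUT for ideation; nothing asserts HC / HC_AV / any Weil-class statement.
-/

noncomputable section

open CategoryTheory

namespace Literature.AlgebraicGeometry.Hyperkaehler

open Literature.AlgebraicTopology.SingularHomology
open Literature.AlgebraicGeometry.HodgeTheory

/-! ## §2 — hard Lefschetz consequences in the top odd degree -/

/-- **Voisin 2022, Cor. 2.4 (REFEREED): "If `X` is a hyper-Kähler manifold of dimension `2n` with
`H^{2n-1}(X,ℚ) ≠ 0`, the cup-product map `⋀² H^{2n-1}(X,ℚ) → H²(X,ℚ)^*` [`= H^{4n-2}(X,ℚ)` by Poincaré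
duality] is surjective."**  Rendering (module docstring): for `1 ≤ n` and `X` a projective irreducible
symplectic variety of dimension `2n` with `b_{2n-1}(X) ≠ 0`, the `ℂ`-span of the cup products `a ∪ b`,
`a, b ∈ H^{2n-1}(X(ℂ); ℂ)`, is all of `H^{(2n-1)+(2n-1)}(X(ℂ); ℂ) = H^{4n-2}(X(ℂ); ℂ)` (the target degree
is spelled `(2n-1)+(2n-1)`, the cup product's own, so that the statement carries no cast).  Projective case
of the printed (compact hyper-Kähler) statement — weaker than print.  A published THEOREM recorded as a named fact.
[cite: Voisin2022FootnotesOGradyMarkman, Cor. 2.4 (§2.2; arXiv:2106.06979 p. 4)] -/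
def Voisin2022_cupProduct_topOddDegree_span_eq_top : Prop :=
  ∀ (n : ℕ) (hn : 1 ≤ n) (X : Motives.SchemeOver ℂ), IsProjectiveIrreducibleSymplectic (2 * n) X →
    Module.finrank ℂ (complexBetti X (2 * n - 1)) ≠ 0 →
      Submodule.span ℂ (Set.range fun ab : complexBetti X (2 * n - 1) × complexBetti X (2 * n - 1) ↦
        cupProduct (rfl : 2 * n - 1 + (2 * n - 1) = 2 * n - 1 + (2 * n - 1)) ab.1 ab.2) = ⊤

/-- **Voisin 2022, Lemma 2.5 (REFEREED): "Let `X` be a hyper-Kähler `2n`-fold. Then the Hodge structure on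
the quotient `H^{2n-1}(X,ℚ)⁰ := H^{2n-1}(X,ℚ)/H² ∪ H^{2n-3}(X,ℚ)` has Hodge level `1`", i.e. (its proof,
verbatim) "any class in `H^{p,q}(X)` with `p > n` or `q > n` belongs to `H²(X,ℂ) ∪ H^{2n-3}(X,ℂ)`.**
Rendering: for `2 ≤ n`, `X` projective irreducible symplectic of dimension `2n`, every class
`c ∈ H^{2n-1}(X(ℂ); ℂ)` of Hodge type `(p,q)`, `p + q = 2n - 1`, with `n < p` or `n < q`, lies in the
`ℂ`-span of `{a ∪ b : a ∈ H²(X(ℂ); ℂ), b ∈ H^{2n-3}(X(ℂ); ℂ)}` (the degree `2n - 1` is spelled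
`2 + (2n - 3)`, the cup product's own target degree, so that the statement carries no cast; `2 ≤ n`).  (Proof in print: `σ_X^l ∧` is an
isomorphism `Ω^{n-l} ≅ Ω^{n+l}`, so `H^{n+l,q} = σ^l ∪ H^{n-l,q}`.)  Projective case of print.
[cite: Voisin2022FootnotesOGradyMarkman, Lemma 2.5 (§2.2; arXiv:2106.06979 pp. 4–5)] -/
def Voisin2022_hodgeLevel_topOddDegree : Prop :=
  ∀ (n : ℕ) (hn : 2 ≤ n) (X : Motives.SchemeOver ℂ), IsProjectiveIrreducibleSymplectic (2 * n) X →
    ∀ (p q : ℕ) (c : complexBetti X (2 + (2 * n - 3))), p + q = 2 + (2 * n - 3) → (n < p ∨ n < q) →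
      IsOfHodgeType (2 * n) X (2 + (2 * n - 3)) p q c →
        c ∈ Submodule.span ℂ (Set.range fun ab : complexBetti X 2 × complexBetti X (2 * n - 3) ↦
          cupProduct (rfl : 2 + (2 * n - 3) = 2 + (2 * n - 3)) ab.1 ab.2)

/-! ## §3.1 — lower bounds on odd Betti numbers from the universality of the Kuga–Satake construction -/

/-- **Voisin 2022, Thm. 3.3 (= Thm. 1.3 (3); REFEREED): "Let `X` be a hyper-Kähler manifold. Assume that
`b₃(X) ≠ 0`. Then `b₃(X) ≥ 2ᵏ`, where `k = (b₂(X)-1)/2` if `b₂(X)` is odd, `k = (b₂(X)-2)/2` if `b₂(X)` is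
even.  If `b₂(X)` is divisible by `4`, the last inequality can be improved to `b₃(X) ≥ 2^{b₂(X)/2}`."**
Rendering: for `X` projective irreducible symplectic of dimension `2n` with `b₃ ≠ 0`:
`2^{⌊(b₂-1)/2⌋} ≤ b₃`, and `4 ∣ b₂ → 2^{b₂/2} ≤ b₃` (`bₖ = dim_ℂ Hᵏ(X(ℂ); ℂ)`; `⌊(b₂-1)/2⌋` is print's `k`
for both parities, module docstring).  For `Kumⁿ`-type (`b₂ = 7`, `b₃ = 8`) the bound `2³` is sharp.
Projective case of print.  A published THEOREM recorded as a named fact.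
[cite: Voisin2022FootnotesOGradyMarkman, Thm. 3.3 (§3.1; arXiv:2106.06979 p. 7) and Thm. 1.3 (3)] -/
def Voisin2022_thirdBetti_lowerBound : Prop :=
  ∀ (n : ℕ) (X : Motives.SchemeOver ℂ), IsProjectiveIrreducibleSymplectic (2 * n) X →
    Module.finrank ℂ (complexBetti X 3) ≠ 0 →
      2 ^ ((Module.finrank ℂ (complexBetti X 2) - 1) / 2) ≤ Module.finrank ℂ (complexBetti X 3) ∧
        (4 ∣ Module.finrank ℂ (complexBetti X 2) →
          2 ^ (Module.finrank ℂ (complexBetti X 2) / 2) ≤ Module.finrank ℂ (complexBetti X 3))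

/-- **Voisin 2022, Thm. 3.4 (REFEREED): "Let `X` be a hyper-Kähler manifold such that `H^{2n-3}(X) = 0` and
`H^{2n-1}(X) ≠ 0`. Then `b_{2n-1}(X) ≥ 2ᵏ`, where `k = (b₂(X)-1)/2` if `b₂(X)` is odd, `k = (b₂(X)-2)/2` if
`b₂(X)` is even.  If `b₂(X)` is divisible by `4`, the last inequality can be improved to
`b_{2n-1}(X) ≥ 2^{b₂(X)/2}`."**  Rendering: for `2 ≤ n`, `X` projective irreducible symplectic of dimension
`2n` with `b_{2n-3} = 0` and `b_{2n-1} ≠ 0`: `2^{⌊(b₂-1)/2⌋} ≤ b_{2n-1}`, and `4 ∣ b₂ → 2^{b₂/2} ≤ b_{2n-1}`.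
(Proof in print: Cor. 2.4 + Lemma 2.5 put `H^{2n-1}` in the situation of Thm. 3.3.)  Projective case of
print.  A published THEOREM recorded as a named fact.
[cite: Voisin2022FootnotesOGradyMarkman, Thm. 3.4 (§3.1; arXiv:2106.06979 pp. 7–8)] -/
def Voisin2022_topOddBetti_lowerBound : Prop :=
  ∀ (n : ℕ) (hn : 2 ≤ n) (X : Motives.SchemeOver ℂ), IsProjectiveIrreducibleSymplectic (2 * n) X →
    Module.finrank ℂ (complexBetti X (2 * n - 3)) = 0 →
      Module.finrank ℂ (complexBetti X (2 * n - 1)) ≠ 0 →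
        2 ^ ((Module.finrank ℂ (complexBetti X 2) - 1) / 2) ≤ Module.finrank ℂ (complexBetti X (2 * n - 1)) ∧
          (4 ∣ Module.finrank ℂ (complexBetti X 2) →
            2 ^ (Module.finrank ℂ (complexBetti X 2) / 2) ≤ Module.finrank ℂ (complexBetti X (2 * n - 1)))

/-! ## Cor. 3.5 — derived in the kernel from Thm. 3.3 and Thm. 3.4 (the printed proof) -/

/-- `b₁ = 0` for a projective irreducible symplectic variety: `X(ℂ)` is simply connected, so
`H¹(X(ℂ); ℂ) = 0` (Hatcher, Thm. 2A.1 and §3.1: `H₁ = π₁^{ab} = 0`, `H¹ = Hom(H₁, ℂ)`; tree theorem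
`isZero_singularCohomology_one_of_simplyConnectedSpace`). [cite: HatcherAT2002, Thm. 2A.1 and §3.1 Thm. 3.2]
[cite: Huybrechts1999, §1 Def. 1.1 (simply connected)] -/
theorem finrank_complexBetti_one_eq_zero_of_isProjectiveIrreducibleSymplectic {d : ℕ}
    {X : Motives.SchemeOver ℂ} (hX : IsProjectiveIrreducibleSymplectic d X) :
    Module.finrank ℂ (complexBetti X 1) = 0 := by
  haveI : SimplyConnectedSpace (Motives.ComplexPoints X) := hX.2.1
  haveI := ModuleCat.subsingleton_of_isZero
    (isZero_singularCohomology_one_of_simplyConnectedSpace (X := Motives.ComplexPoints X) ℂ)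
  exact Module.finrank_zero_of_subsingleton

/-- Hard Lefschetz symmetry of Betti numbers of a smooth projective `n`-fold: `bₖ = b_{k+2j}` for
`k + j = n` (`Lʲ : Hᵏ ≅ H^{2n-k}`, tree theorem `nonempty_hardLefschetzNFold_holds`).
[cite: VoisinHodgeI2002, Thm. 6.25] -/
theorem finrank_complexBetti_eq_of_hardLefschetz {n : ℕ} {X : Motives.SchemeOver ℂ}
    (hX : Motives.IsSmoothProjective n X) {j k : ℕ} (hjk : k + j = n) (m : ℕ) (hm : k + 2 * j = m) :
    Module.finrank ℂ (complexBetti X k) = Module.finrank ℂ (complexBetti X m) := by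
  obtain ⟨Λ⟩ := nonempty_hardLefschetzNFold_holds n X hX
  exact (LinearEquiv.ofBijective (Λ.L j k m hm) (Λ.bijective_L hjk m hm)).finrank_eq

/-- **Voisin 2022, Cor. 3.5 (= Cor. 1.4; REFEREED) — DERIVED from Thm. 3.3 and Thm. 3.4 exactly as printed:
"Let `X` be a hyper-Kähler `6`-fold such that `H^{odd}(X) ≠ 0`. Then `b_{odd}(X) ≥ 2ᵏ`, where
`k = (b₂-2)/2` if `b₂` is even, `k = (b₂-1)/2` if `b₂` is odd.  Proof. … if `H^{odd}(X) ≠ 0`, then either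
`H³(X,ℚ) ≠ 0` or, `H³(X,ℚ) = 0` and `H⁵(X,ℚ) ≠ 0`. In the first case we apply Theorem 3.3 and in the second
case we apply Theorem 3.4."**  Here `b_{odd} = b₁ + b₃ + b₅ + b₇ + b₉ + b₁₁` (all odd degrees of a sixfold),
and the case analysis uses `b₁ = 0` (simply connected) and `b₇ = b₅`, `b₉ = b₃`, `b₁₁ = b₁` (hard Lefschetz),
both theorems of the tree.  Projective case of print; conditional only on the two records it consumes.
[cite: Voisin2022FootnotesOGradyMarkman, Cor. 3.5 (§3.1; arXiv:2106.06979 p. 8) and Cor. 1.4] -/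
theorem Voisin2022_oddBetti_sixfold_lowerBound (h33 : Voisin2022_thirdBetti_lowerBound)
    (h34 : Voisin2022_topOddBetti_lowerBound) {X : Motives.SchemeOver ℂ}
    (hX : IsProjectiveIrreducibleSymplectic 6 X)
    (hodd : ∑ i ∈ Finset.range 6, Module.finrank ℂ (complexBetti X (2 * i + 1)) ≠ 0) :
    2 ^ ((Module.finrank ℂ (complexBetti X 2) - 1) / 2) ≤
      ∑ i ∈ Finset.range 6, Module.finrank ℂ (complexBetti X (2 * i + 1)) := by
  have hsp : Motives.IsSmoothProjective 6 X := hX.1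
  have h1 : Module.finrank ℂ (complexBetti X 1) = 0 :=
    finrank_complexBetti_one_eq_zero_of_isProjectiveIrreducibleSymplectic hX
  have h7 : Module.finrank ℂ (complexBetti X 7) = Module.finrank ℂ (complexBetti X 5) :=
    (finrank_complexBetti_eq_of_hardLefschetz hsp (j := 1) (k := 5) rfl 7 rfl).symm
  have h9 : Module.finrank ℂ (complexBetti X 9) = Module.finrank ℂ (complexBetti X 3) :=
    (finrank_complexBetti_eq_of_hardLefschetz hsp (j := 3) (k := 3) rfl 9 rfl).symm
  have h11 : Module.finrank ℂ (complexBetti X 11) = Module.finrank ℂ (complexBetti X 1) :=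
    (finrank_complexBetti_eq_of_hardLefschetz hsp (j := 5) (k := 1) rfl 11 rfl).symm
  have hle : ∀ i ∈ Finset.range 6, Module.finrank ℂ (complexBetti X (2 * i + 1)) ≤
      ∑ i ∈ Finset.range 6, Module.finrank ℂ (complexBetti X (2 * i + 1)) :=
    fun i hi ↦ Finset.single_le_sum (f := fun i ↦ Module.finrank ℂ (complexBetti X (2 * i + 1)))
      (fun _ _ ↦ Nat.zero_le _) hi
  by_cases h3 : Module.finrank ℂ (complexBetti X 3) ≠ 0
  · exact ((h33 3 X hX h3).1).trans (hle 1 (by simp))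
  · rw [ne_eq, not_not] at h3
    have h5 : Module.finrank ℂ (complexBetti X 5) ≠ 0 := by
      intro h5
      apply hodd
      simp only [Finset.sum_range_succ, Finset.sum_range_zero]
      norm_num [h1, h3, h5, h7, h9, h11]
    exact ((h34 3 (by norm_num) X hX h3 h5).1).trans (hle 2 (by simp))

/-! ## Numerical instances of the bounds (sanity; Betti numbers of the known deformation types as INPUT numerals) -/

/-- `Kumⁿ`: `b₂ = 7` gives the bound `2^{(7-1)/2} = 8`, equal to `b₃(Kumⁿ) = 8` (O'Grady 2021, p. 2:
"`b₃(X) = 8`") — Thm. 3.3 is sharp there. [cite: OGrady2021KummerTori, §1 (arXiv:1805.12075 p. 2)] -/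
example : 2 ^ ((7 - 1) / 2) = 8 := by decide

/-- K3^[n]: `b₂ = 23` would force `b₃ ≥ 2¹¹ = 2048` if `b₃ ≠ 0` (it is `0`); OG6 / OG10: `b₂ = 8, 24`,
`4 ∣ b₂`, would force `b₃ ≥ 2⁴` resp. `2¹²` (odd Betti numbers vanish, `OGradySixReference.finrank_complexBetti_odd`).
[cite: Voisin2022FootnotesOGradyMarkman, Thm. 3.3] -/
example : 2 ^ ((23 - 1) / 2) = 2048 ∧ 2 ^ (8 / 2) = 16 ∧ 2 ^ (24 / 2) = 4096 := by decide

/-- Thm. 3.3 at the `Kumⁿ` value `b₂ = 7`: `b₃ ≠ 0 ⇒ 8 ≤ b₃`. [cite: Voisin2022FootnotesOGradyMarkman, Thm. 3.3] -/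
theorem Voisin2022_thirdBetti_lowerBound.of_betti_two_eq_seven (h : Voisin2022_thirdBetti_lowerBound)
    {n : ℕ} {X : Motives.SchemeOver ℂ} (hX : IsProjectiveIrreducibleSymplectic (2 * n) X)
    (hb₂ : Module.finrank ℂ (complexBetti X 2) = 7) (hb₃ : Module.finrank ℂ (complexBetti X 3) ≠ 0) :
    8 ≤ Module.finrank ℂ (complexBetti X 3) := by
  have := (h n X hX hb₃).1
  rw [hb₂] at this
  simpa using this

/-! ## Lens corollaries (kernel, modulo Thm. 3.3): which hyper-Kähler hosts can have an abelian SIXFOLD / EIGHTFOLD as `J³(X)`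

`dim J³(X) = b₃(X)/2` (`J³(X) = H³(X,ℂ)/(F² ⊕ H³(X,ℤ))`, Voisin §1 p0003:L3–L4: "As `b₃(X) = 8`, `J³(X)` is an
abelian fourfold").  The HodgeAV ladder's "transfer lens" asks for hosts whose intermediate Jacobian is a
Weil-type abelian SIXFOLD (`b₃ = 12`, rung H2) or EIGHTFOLD (`b₃ = 16`, the split-eightfold trigger of H2);
Thm. 3.3 bounds their second Betti number.  Pure arithmetic from the record; numbers, not adjectives. -/

/-- **A projective irreducible symplectic host with `b₃ = 12` (so that `J³(X)` is an abelian SIXFOLD) has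
`b₂ ≤ 7`** — from Thm. 3.3: `2^{⌊(b₂-1)/2⌋} ≤ 12` forces `b₂ ≤ 8`, and `b₂ = 8` is excluded by the
improvement `4 ∣ b₂ ⇒ 2^{b₂/2} = 16 ≤ 12`.  (All known deformation types have `b₃ ∈ {0, 8}`; this is a
constraint on HYPOTHETICAL hosts.) [cite: Voisin2022FootnotesOGradyMarkman, Thm. 3.3] -/
theorem Voisin2022_thirdBetti_lowerBound.betti_two_le_seven_of_thirdBetti_eq_twelve
    (h : Voisin2022_thirdBetti_lowerBound) {n : ℕ} {X : Motives.SchemeOver ℂ}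
    (hX : IsProjectiveIrreducibleSymplectic (2 * n) X) (hb₃ : Module.finrank ℂ (complexBetti X 3) = 12) :
    Module.finrank ℂ (complexBetti X 2) ≤ 7 := by
  obtain ⟨h1, h2⟩ := h n X hX (by rw [hb₃]; decide)
  rw [hb₃] at h1 h2
  generalize Module.finrank ℂ (complexBetti X 2) = b at h1 h2 ⊢
  have hk : (b - 1) / 2 ≤ 3 := by
    by_contra hc
    have : 2 ^ 4 ≤ 2 ^ ((b - 1) / 2) := Nat.pow_le_pow_right (by norm_num) (by omega)
    omega
  have hb8 : b ≤ 8 := by omega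
  rcases Nat.lt_or_ge b 8 with hlt | hge
  · omega
  · have hb : b = 8 := le_antisymm hb8 hge
    have := h2 ⟨2, by omega⟩
    rw [hb] at this
    norm_num at this

/-- **A projective irreducible symplectic host with `b₃ = 16` (so that `J³(X)` is an abelian EIGHTFOLD) has
`b₂ ≤ 10`** — from Thm. 3.3: `2^{⌊(b₂-1)/2⌋} ≤ 16` forces `⌊(b₂-1)/2⌋ ≤ 4`; the `4 ∣ b₂` improvement
excludes nothing further (`b₂ = 8`: `2⁴ = 16 ≤ 16`). [cite: Voisin2022FootnotesOGradyMarkman, Thm. 3.3] -/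
theorem Voisin2022_thirdBetti_lowerBound.betti_two_le_ten_of_thirdBetti_eq_sixteen
    (h : Voisin2022_thirdBetti_lowerBound) {n : ℕ} {X : Motives.SchemeOver ℂ}
    (hX : IsProjectiveIrreducibleSymplectic (2 * n) X) (hb₃ : Module.finrank ℂ (complexBetti X 3) = 16) :
    Module.finrank ℂ (complexBetti X 2) ≤ 10 := by
  obtain ⟨h1, -⟩ := h n X hX (by rw [hb₃]; decide)
  rw [hb₃] at h1
  generalize Module.finrank ℂ (complexBetti X 2) = b at h1 ⊢
  have hk : (b - 1) / 2 ≤ 4 := by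
    by_contra hc
    have : 2 ^ 5 ≤ 2 ^ ((b - 1) / 2) := Nat.pow_le_pow_right (by norm_num) (by omega)
    omega
  omega

end Literature.AlgebraicGeometry.Hyperkaehler

end
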